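import Literature.Analysis.FluidPDE.SuitableWeakSliced
import Literature.Analysis.FluidPDE.NSCylinderVelocityCompactness
import Literature.Analysis.FluidPDE.LocalEnergyTimeCompactness
import Literature.Analysis.FluidPDE.LocalEnergyWeakContinuity
import Literature.Analysis.FluidPDE.SolenoidalSlabDuality
import HarnessLib

/-!
# Suitable weak solutions restart at almost every time: the local energy inequality from an
# interior time, pairing continuity, and strong `L²_loc` right-continuity of the slices

Analysis/FluidPDE proofs-only file (theorems only: no definitions, no named facts), first file of
a second line of attack on the named fact `Literature.Analysis.FluidPDE.ess_local_holder`
(Escauriaza–Seregin–Šverák 2003, Thm. 1.4; `NSLerayHopfProofs.lean`) through Lemarié-Rieusset's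
backward uniqueness theorem for local Leray solutions (the named fact
`lemarieRieusset_backward_uniqueness_slab`, *The Navier–Stokes Problem in the 21st Century*
(2016), Thm. 15.4): the blow-up limit of an `L_{3,∞}` suitable pair around a point of
`ε`-concentration (`exists_blowup_limit`, `ESSLocalHolderBlowupLimit.lean`) is a local energy
ancient solution with `L³` slices which vanishes at the final time (`blowup_top_vanishing`), and
Thm. 15.4 applies to it **restarted at almost every time** — Lemarié-Rieusset 2016, p. 568: "for
almost every `T₃ ∈ (T₀, T₁)`, `u` is a local Leray solution on `(T₃, T₁)`"; Seregin 2014,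
Remark B.4. The restart needs the datum `u(T₃)` to be attained **strongly** in `L²_loc`
(clause (3) of the tree's `IsLocalLeraySolutionOn`, Kang–Miura–Tsai Def. 3.2), and this file
proves that property for general suitable weak solutions (Caffarelli–Kohn–Nirenberg 1982,
(2.1)–(2.5), the tree's `IsSuitableWeakSolutionOn`) on open sets containing a slab `(a, b) × E`:

* `ae_energy_le_of_start_Ioo` — **the local energy inequality from almost every interior time**:
  for smooth compactly supported `φ = φ(x) ≥ 0`, for a.e. `s₀` and then a.e. `t > s₀`,
  `∫ |u(t)|² φ ≤ ∫ |u(s₀)|² φ + ∫∫_{[s₀,t) × E} (|u|² νΔφ + (|u|² + 2p) u·∇φ)`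
  (the accepted sliced inequality `IsSuitableWeakSolutionOn.ae_localEnergy_slice`, CKN (2.5),
  tested with `(1 - η_ε(τ)) η_top(τ) φ(x)` and `ε → 0` at a Lebesgue point `s₀` of
  `τ ↦ ∫ |u(τ)|² φ`, with the kernels and Lebesgue-point lemma of `SlicedLocalEnergy.lean`);
* `exists_fullMeasure_tendsto_pairing`, `exists_goodSet` — continuity of the pairings
  `t ↦ ∫_{B(0,r)} ⟪u(t), ψ⟫` along a set of full measure (the tree's
  `NSCylinder.exists_fullMeasure_pairing_modulus`, Robinson–Rodrigo–Sadowski 2016, Lemma 13.8);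
* `tendsto_integral_norm_sub_sq_mul` — the Hilbert-space step: energy control
  `limsup ∫ |v(t)|² φ ≤ ∫ |v(s₀)|² φ` plus convergence of the pairings against a dense family
  give `∫ |v(t) − v(s₀)|² φ → 0`;
* `ae_tendsto_lintegral_ball_sub_sq` — **strong `L²_loc` right-continuity at almost every
  time**: on `ℝ³`, viscosity `1`, for a.e. `s₀ ∈ (a, b)` there is a set `S` of full measure with
  `∫_{B(0,r)} |u(t) − u(s₀)|² → 0` as `t ↓ s₀`, `t ∈ S`, for every `r`;
* `ae_isWeaklyDivFree_slice` — a.e. slice is weakly divergence free (CKN (2.2) sliced; the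
  tree's `ae_integral_inner_gradient_eq_zero` and `ae_isWeaklyDivFree_of_forall_test`).

Nothing accepted is restated or changed; no `sorry`.

## References

* L. Caffarelli, R. Kohn, L. Nirenberg, *Partial regularity of suitable weak solutions of the
  Navier–Stokes equations*, Comm. Pure Appl. Math. 35 (1982), §2, (2.1)–(2.5).
  [`CaffarelliKohnNirenberg1982`]
* P. G. Lemarié-Rieusset, *The Navier–Stokes Problem in the 21st Century*, CRC Press (2016),
  doi:10.1201/b19556: Prop. 14.1 (`limsup_{t→0} ∫|u(t)|²φ ≤ ∫|u₀|²φ`), Thm. 15.4 and its proof,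
  PDF p. 568 ("for almost every `T₃ ∈ (T₀, T₁)`, `u` is a local Leray solution on `(T₃, T₁)`").
  [`LemarieRieusset2016`]
* G. Seregin, *Lecture Notes on Regularity Theory for the Navier–Stokes Equations*, World
  Scientific (2014), App. B, Remarks B.3–B.4. [`Seregin2014`]
* J. C. Robinson, J. L. Rodrigo, W. Sadowski, *The Three-Dimensional Navier–Stokes Equations*,
  CUP (2016), §13.5, Lemma 13.8; proof of Prop. 5.3. [`RobinsonRodrigoSadowski2016`]
* L. Escauriaza, G. Seregin, V. Šverák, Russ. Math. Surveys 58:2 (2003) 211–250, Thm. 1.4, §3.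
  [`EscauriazaSereginSverak2003`]
-/

noncomputable section

open MeasureTheory TopologicalSpace Set Function Filter Topology Metric InnerProductSpace
open scoped ENNReal NNReal RealInnerProductSpace Laplacian

namespace Literature.Analysis.FluidPDE

namespace SuitableRestart

/-! ### Test functions of product form and two integrability tools -/

section Tools

variable {E : Type*} [NormedAddCommGroup E] [InnerProductSpace ℝ E]

/-- A space–time test function of product form `θ(t) φ(x)` on an open set containing the slab
`(a, b) × E`: `θ` smooth and vanishing off a compact interval `[a₁, b₁] ⊆ (a, b)`, `φ` smooth with
compact support. [folklore] -/
theorem isSpaceTimeTestOn_mul {Q : Opens (ℝ × E)} {a b : ℝ}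
    (hab : Ioo a b ×ˢ (univ : Set E) ⊆ (Q : Set (ℝ × E))) {θ : ℝ → ℝ}
    (hθ : ContDiff ℝ (⊤ : ℕ∞) θ) {a₁ b₁ : ℝ} (h₁ : Icc a₁ b₁ ⊆ Ioo a b)
    (hθ0 : ∀ t, t ∉ Icc a₁ b₁ → θ t = 0) {φ : E → ℝ} (hφ : ContDiff ℝ (⊤ : ℕ∞) φ)
    (hφc : HasCompactSupport φ) :
    IsSpaceTimeTestOn Q (fun t x => θ t * φ x) := by
  have hK : IsCompact (Icc a₁ b₁ ×ˢ tsupport φ) := isCompact_Icc.prod hφc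
  have hzero : ∀ z : ℝ × E, z ∉ Icc a₁ b₁ ×ˢ tsupport φ →
      uncurry (fun t x => θ t * φ x) z = 0 := by
    rintro ⟨t, x⟩ hz
    rcases not_and_or.1 (fun h => hz (mem_prod.2 h)) with h | h
    · simp [uncurry, hθ0 t h]
    · simp [uncurry, image_eq_zero_of_notMem_tsupport h]
  have hts : tsupport (uncurry fun t x => θ t * φ x) ⊆ Icc a₁ b₁ ×ˢ tsupport φ :=
    closure_minimal (fun z hz => by_contra fun h => hz (hzero z h))
      (isClosed_Icc.prod (isClosed_tsupport φ))
  refine ⟨(hθ.comp contDiff_fst).mul (hφ.comp contDiff_snd), HasCompactSupport.intro hK hzero, ?_⟩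
  exact hts.trans ((prod_mono h₁ (subset_univ _)).trans hab)

/-- The Laplacian of a `C²` function is continuous (sum of second derivatives along an
orthonormal basis). [folklore] -/
theorem continuous_laplacian_two {F : Type*} [NormedAddCommGroup F] [NormedSpace ℝ F]
    [FiniteDimensional ℝ E] {f : E → F} (hf : ContDiff ℝ 2 f) : Continuous (Δ f) := by
  rw [laplacian_eq_iteratedFDeriv_stdOrthonormalBasis]
  refine continuous_finsetSum _ fun i _ => ?_
  exact (hf.continuous_iteratedFDeriv le_rfl).eval_const _

end Tools

/-! ### The local energy inequality from almost every interior time -/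

section Start

variable {E : Type*} [NormedAddCommGroup E] [InnerProductSpace ℝ E] [FiniteDimensional ℝ E]
  [MeasurableSpace E] [BorelSpace E]

variable {Q : Opens (ℝ × E)} {ν : ℝ} {u : ℝ → E → E} {p : ℝ → E → ℝ}

/-- The inner product of a field integrable on a compact space–time set with a continuous field
is integrable on that set. [folklore] -/
theorem integrableOn_inner_of_continuous {K : Set (ℝ × E)} (hK : IsCompact K)
    {V w : ℝ × E → E} (hV : IntegrableOn V K volume) (hw : Continuous w) :
    IntegrableOn (fun z => ⟪V z, w z⟫) K volume := by
  obtain ⟨C, hC⟩ := hK.exists_bound_of_continuousOn hw.continuousOn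
  refine Integrable.mono' (hV.norm.mul_const C)
    (hV.aestronglyMeasurable.inner hw.aestronglyMeasurable.restrict) ?_
  filter_upwards [ae_restrict_mem₀ hK.measurableSet.nullMeasurableSet] with z hz
  calc ‖⟪V z, w z⟫‖ ≤ ‖V z‖ * ‖w z‖ := norm_inner_le_norm _ _
    _ ≤ ‖V z‖ * C := mul_le_mul_of_nonneg_left (hC z hz) (norm_nonneg _)

/-- **Integrability of the right-hand side of the local energy inequality on compact time windows**:
for a suitable weak solution on `Q ⊇ (a, b) × E` with `|u|³ ∈ L¹_loc(Q)` and a smooth compactly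
supported `φ = φ(x)`, the field `|u|² νΔφ + (|u|² + 2p) u·∇φ` is integrable on `[c₁, c₂] × E`
whenever `[c₁, c₂] ⊆ (a, b)` (it vanishes off `[c₁, c₂] × tsupport φ`, a compact subset of `Q`).
[folklore] -/
theorem integrableOn_energyRHS_Icc_prod (hs : IsSuitableWeakSolutionOn Q ν 0 u p)
    (hu3 : LocallyIntegrableOn (fun z : ℝ × E => ‖u z.1 z.2‖ ^ 3) (Q : Set (ℝ × E)) volume)
    {a b : ℝ} (hab : Ioo a b ×ˢ (univ : Set E) ⊆ (Q : Set (ℝ × E)))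
    {φ : E → ℝ} (hφ : ContDiff ℝ (⊤ : ℕ∞) φ) (hφc : HasCompactSupport φ) {c₁ c₂ : ℝ}
    (hc : Icc c₁ c₂ ⊆ Ioo a b) :
    IntegrableOn (fun z : ℝ × E => ‖u z.1 z.2‖ ^ 2 * (ν * Δ φ z.2) +
        (‖u z.1 z.2‖ ^ 2 + 2 * p z.1 z.2) * ⟪u z.1 z.2, gradient φ z.2⟫)
      (Icc c₁ c₂ ×ˢ (univ : Set E)) volume := by
  set K : Set (ℝ × E) := Icc c₁ c₂ ×ˢ tsupport φ with hK
  have hKc : IsCompact K := isCompact_Icc.prod hφc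
  have hKQ : K ⊆ (Q : Set (ℝ × E)) := (prod_mono hc (subset_univ _)).trans hab
  have hKm : MeasurableSet K := hKc.measurableSet
  have hφ2 : ContDiff ℝ 2 φ := contDiff_infty.1 hφ 2
  have hΔc : Continuous (Δ φ) := continuous_laplacian_two hφ2
  have hgc : Continuous (gradient φ) := continuous_gradient_of_contDiff (contDiff_infty.1 hφ 1)
  have hu2 : LocallyIntegrableOn (fun z : ℝ × E => ‖u z.1 z.2‖ ^ 2) (Q : Set (ℝ × E)) volume :=
    hs.distributional.2.1
  have h1 : IntegrableOn (fun z : ℝ × E => ‖u z.1 z.2‖ ^ 2 * (ν * Δ φ z.2)) K volume :=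
    (hu2.integrableOn_compact_subset hKQ hKc).mul_continuousOn
      (continuous_const.mul (hΔc.comp continuous_snd)).continuousOn hKc
  have h2 : IntegrableOn (fun z : ℝ × E =>
      ⟪uncurry (fun t x => (‖u t x‖ ^ 2 + 2 * p t x) • u t x) z, gradient φ z.2⟫) K volume :=
    integrableOn_inner_of_continuous hKc
      ((hs.locallyIntegrableOn_cubic hu3).integrableOn_compact_subset hKQ hKc)
      (hgc.comp continuous_snd)
  have hK' : IntegrableOn (fun z : ℝ × E => ‖u z.1 z.2‖ ^ 2 * (ν * Δ φ z.2) +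
      (‖u z.1 z.2‖ ^ 2 + 2 * p z.1 z.2) * ⟪u z.1 z.2, gradient φ z.2⟫) K volume := by
    refine (h1.add h2).congr_fun (fun z _ => ?_) hKm
    simp only [uncurry, real_inner_smul_left, Pi.add_apply]
  refine hK'.of_forall_sdiff_eq_zero (measurableSet_Icc.prod MeasurableSet.univ) fun z hz => ?_
  have hz2 : z.2 ∉ tsupport φ := fun h => hz.2 (mem_prod.2 ⟨(mem_prod.1 hz.1).1, h⟩)
  rw [laplacian_eq_zero_of_notMem_tsupport hz2, gradient_eq_zero_of_notMem_tsupport hz2]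
  simp

/-- **The local energy inequality of a suitable weak solution from almost every interior time**,
core step on a compact time window. Let `(u, p)` be a suitable weak solution (no force,
viscosity `ν ≥ 0`) on an open `Q ⊇ (a, b) × E` with `|u|³ ∈ L¹_loc(Q)`, and `φ ≥ 0` a smooth
compactly supported function of `x`. For `a < a'`, `b' < b`: for a.e. `s₀ ∈ (a', b')` and then a.e.
`t ∈ (s₀, b')`,
`∫ |u(t)|² φ ≤ ∫ |u(s₀)|² φ + ∫∫_{[s₀,t) × E} (|u|² νΔφ + (|u|² + 2p) u·∇φ)`.
(Test the CKN inequality, sliced at `t` (`ae_localEnergy_slice`), with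
`(1 - η_ε(τ)) η_top(τ) φ(x)`, `η_ε` the smooth cut-offs of `exists_time_cutoff` concentrating to
the left of `s₀`, and let `ε → 0` at a Lebesgue point `s₀` of `τ ↦ ∫ |u(τ)|² φ`;
Caffarelli–Kohn–Nirenberg 1982, (2.5); Lemarié-Rieusset 2016, p. 568: "for almost every
`T₃ ∈ (T₀, T₁)`, `u` is a local Leray solution on `(T₃, T₁)`".) [cite: CaffarelliKohnNirenberg1982, §2 (2.5)] -/
theorem ae_energy_le_of_start_Ioo
    (hs : IsSuitableWeakSolutionOn Q ν 0 u p) (hν : 0 ≤ ν)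
    (hu3 : LocallyIntegrableOn (fun z : ℝ × E => ‖u z.1 z.2‖ ^ 3) (Q : Set (ℝ × E)) volume)
    {a b : ℝ} (hab : Ioo a b ×ˢ (univ : Set E) ⊆ (Q : Set (ℝ × E)))
    {φ : E → ℝ} (hφ : ContDiff ℝ (⊤ : ℕ∞) φ) (hφc : HasCompactSupport φ) (hφ0 : ∀ x, 0 ≤ φ x)
    {a' b' : ℝ} (ha' : a < a') (hb' : b' < b) :
    ∀ᵐ s₀ ∂(volume : Measure ℝ), s₀ ∈ Ioo a' b' →
      ∀ᵐ t ∂(volume : Measure ℝ), t ∈ Ioo s₀ b' →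
        ∫ x, ‖u t x‖ ^ 2 * φ x ≤ (∫ x, ‖u s₀ x‖ ^ 2 * φ x) +
          ∫ z in Ico s₀ t ×ˢ (univ : Set E),
            (‖u z.1 z.2‖ ^ 2 * (ν * Δ φ z.2) +
              (‖u z.1 z.2‖ ^ 2 + 2 * p z.1 z.2) * ⟪u z.1 z.2, gradient φ z.2⟫) := by
  rcases le_or_gt b' a' with hba | hba
  · exact Eventually.of_forall fun s₀ hs₀ => absurd (hs₀.1.trans hs₀.2) (not_lt.2 hba)
  -- ## the geometry: `a < a' < b' < b'' < b`
  set b'' : ℝ := (b' + b) / 2 with hb''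
  have hb'b'' : b' < b'' := by rw [hb'']; linarith
  have hb''b : b'' < b := by rw [hb'']; linarith
  set K : Set (ℝ × E) := Icc a' b'' ×ˢ tsupport φ with hK
  have hKc : IsCompact K := isCompact_Icc.prod hφc
  have hIcc : Icc a' b'' ⊆ Ioo a b := fun t ht => ⟨ha'.trans_le ht.1, ht.2.trans_lt hb''b⟩
  have hKQ : K ⊆ (Q : Set (ℝ × E)) := (prod_mono hIcc (subset_univ _)).trans hab
  have hKm : MeasurableSet K := hKc.measurableSet
  -- ## continuity / support facts for `φ`
  have hφcont : Continuous φ := hφ.continuous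
  have hφ2 : ContDiff ℝ 2 φ := contDiff_infty.1 hφ 2
  have hφK : ∀ x ∉ tsupport φ, φ x = 0 := fun x hx => image_eq_zero_of_notMem_tsupport hx
  have hΔK : ∀ x ∉ tsupport φ, Δ φ x = 0 := fun x hx => laplacian_eq_zero_of_notMem_tsupport hx
  have hgK : ∀ x ∉ tsupport φ, gradient φ x = 0 := fun x hx => gradient_eq_zero_of_notMem_tsupport hx
  -- ## the integrands `F = |u|² φ`, `R = |u|² νΔφ + (|u|² + 2p) u·∇φ`
  set F : ℝ × E → ℝ := fun z => ‖u z.1 z.2‖ ^ 2 * φ z.2 with hF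
  set R : ℝ × E → ℝ := fun z => ‖u z.1 z.2‖ ^ 2 * (ν * Δ φ z.2) +
      (‖u z.1 z.2‖ ^ 2 + 2 * p z.1 z.2) * ⟪u z.1 z.2, gradient φ z.2⟫ with hR
  have hFout : ∀ z : ℝ × E, z.2 ∉ tsupport φ → F z = 0 := fun z hz => by
    simp only [hF, hφK z.2 hz, mul_zero]
  have hRout : ∀ z : ℝ × E, z.2 ∉ tsupport φ → R z = 0 := fun z hz => by
    simp only [hR, hΔK z.2 hz, hgK z.2 hz, mul_zero, inner_zero_right, add_zero]
  have hu2 : LocallyIntegrableOn (fun z : ℝ × E => ‖u z.1 z.2‖ ^ 2) (Q : Set (ℝ × E)) volume :=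
    hs.distributional.2.1
  have hFK : IntegrableOn F K volume :=
    (hu2.integrableOn_compact_subset hKQ hKc).mul_continuousOn
      (hφcont.comp continuous_snd).continuousOn hKc
  have hRK : IntegrableOn R K volume :=
    (integrableOn_energyRHS_Icc_prod hs hu3 hab hφ hφc hIcc).mono_set
      (Set.prod_mono Subset.rfl (subset_univ _))
  -- the extensions by zero `W = 1_K F`, `RK = 1_K R`
  set W : ℝ × E → ℝ := K.indicator F with hW
  set RK : ℝ × E → ℝ := K.indicator R with hRK'
  have hIW : Integrable W (volume : Measure (ℝ × E)) := hFK.integrable_indicator hKm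
  have hIRK : Integrable RK (volume : Measure (ℝ × E)) := hRK.integrable_indicator hKm
  -- `W` and `F`, `RK` and `R` agree at points whose time lies in `[a', b'']`
  have hWF : ∀ z : ℝ × E, z.1 ∈ Icc a' b'' → W z = F z := fun z hz => by
    by_cases hz2 : z.2 ∈ tsupport φ
    · exact indicator_of_mem (mem_prod.2 ⟨hz, hz2⟩) F
    · rw [hW, indicator_of_notMem (fun h => hz2 (mem_prod.1 h).2), hFout z hz2]
  have hRKR : ∀ z : ℝ × E, z.1 ∈ Icc a' b'' → RK z = R z := fun z hz => by
    by_cases hz2 : z.2 ∈ tsupport φ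
    · exact indicator_of_mem (mem_prod.2 ⟨hz, hz2⟩) R
    · rw [hRK', indicator_of_notMem (fun h => hz2 (mem_prod.1 h).2), hRout z hz2]
  -- ## Lebesgue points of `U(τ) = ∫ W(τ, x) dx`
  set U : ℝ → ℝ := fun τ => ∫ x, W (τ, x) with hU
  have hIU : Integrable U (volume : Measure ℝ) := by
    have h := hIW
    rw [Measure.volume_eq_prod] at h
    exact h.integral_prod_left
  have hUeq : ∀ τ ∈ Icc a' b'', U τ = ∫ x, ‖u τ x‖ ^ 2 * φ x := fun τ hτ => by
    simp only [hU]
    exact integral_congr_ae (Eventually.of_forall fun x => hWF (τ, x) hτ)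
  have hLeb := IsUnifLocDoublingMeasure.ae_tendsto_average_norm_sub (μ := (volume : Measure ℝ))
    hIU.locallyIntegrable 2
  -- ## the cut-offs
  obtain ⟨C, -, hcut⟩ := exists_time_cutoff
  -- the top cut-off: `ηT = 1` on `(-∞, b']`, `ηT = 0` on `[b'' - (b''-b')/4, ∞)`
  obtain ⟨ηT, kT, hηTs, hηT01, hηT1, hηT0, hηTd, -, -, hkTs, -⟩ :=
    hcut b'' ((b'' - b') / 2) (by linarith)
  have hηT1' : ∀ τ, τ ≤ b' → ηT τ = 1 := fun τ hτ => hηT1 τ (by linarith)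
  have hηT0' : ∀ τ, b'' ≤ τ → ηT τ = 0 := fun τ hτ => hηT0 τ (by linarith)
  have hkT0 : ∀ τ, τ < b' → kT τ = 0 := fun τ hτ => by
    by_contra h
    have := (hkTs τ h).1
    linarith
  -- the structure's weak gradient, and the zero force
  obtain ⟨G₀, hG₀, -, -⟩ := hs.localEnergy
  have hfu : LocallyIntegrableOn (fun z : ℝ × E => ⟪(0 : ℝ → E → E) z.1 z.2, u z.1 z.2⟫)
      (Q : Set (ℝ × E)) volume := by
    have e : (fun z : ℝ × E => ⟪(0 : ℝ → E → E) z.1 z.2, u z.1 z.2⟫) = fun _ => (0 : ℝ) := by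
      funext z; simp
    rw [e]
    exact (locallyIntegrable_const (0 : ℝ)).locallyIntegrableOn _
  have hmeasS : ∀ s : ℝ, MeasurableSet {z : ℝ × E | z.1 < s} := fun s =>
    measurableSet_lt measurable_fst measurable_const
  -- ## the main filter step
  filter_upwards [hLeb] with s₀ hs₀L hs₀I
  obtain ⟨hs₀a, hs₀b⟩ := hs₀I
  -- the bottom cut-offs at `s₀`, of width `εₙ = ε₀/(n+1)`, `ε₀ = (s₀ - a')/2`
  set ε₀ : ℝ := (s₀ - a') / 2 with hε₀
  have hε₀pos : 0 < ε₀ := by rw [hε₀]; linarith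
  set ε : ℕ → ℝ := fun n => ε₀ / ((n : ℝ) + 1) with hε
  have hεpos : ∀ n, 0 < ε n := fun n => by positivity
  have hεle : ∀ n, ε n ≤ ε₀ := fun n => by
    rw [hε]
    exact div_le_self hε₀pos.le (by linarith [n.cast_nonneg (α := ℝ)])
  have hε0 : Tendsto ε atTop (𝓝 0) := by
    have := tendsto_one_div_add_atTop_nhds_zero_nat.const_mul ε₀
    rw [mul_zero] at this
    refine this.congr fun n => ?_
    simp only [hε]; ring
  choose η k hηs hη01 hη1 hη0 hηd hkc hkb hks hk1 using fun n => hcut s₀ (ε n) (hεpos n)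
  have hk0 : ∀ n τ, τ ∉ Icc (s₀ - 2 * ε n) (s₀ - ε n / 2) → k n τ = 0 := fun n τ hτ => by
    by_contra h; exact hτ (hks n τ h)
  -- the time factors `θₙ = (1 - ηₙ) ηT` and the test functions `ζₙ = θₙ φ`
  set θ : ℕ → ℝ → ℝ := fun n τ => (1 - η n τ) * ηT τ with hθ
  set θ' : ℕ → ℝ → ℝ := fun n τ => k n τ * ηT τ + (1 - η n τ) * (-kT τ) with hθ'
  have hθd : ∀ n τ, HasDerivAt (θ n) (θ' n τ) τ := fun n τ => by
    have h1 : HasDerivAt (fun σ => 1 - η n σ) (k n τ) τ := by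
      simpa using (hηd n τ).const_sub (1 : ℝ)
    exact h1.fun_mul (hηTd τ)
  have hθs : ∀ n, ContDiff ℝ (⊤ : ℕ∞) (θ n) := fun n =>
    (contDiff_const.sub (hηs n)).mul hηTs
  have hθ0 : ∀ n τ, τ ∉ Icc (s₀ - 2 * ε n) b'' → θ n τ = 0 := fun n τ hτ => by
    rcases not_and_or.1 (fun h => hτ ⟨h.1, h.2⟩) with h | h
    · simp only [hθ, hη1 n τ (not_le.1 h).le, sub_self, zero_mul]
    · simp only [hθ, hηT0' τ (not_le.1 h).le, mul_zero]
  have hθnn : ∀ n τ, 0 ≤ θ n τ := fun n τ =>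
    mul_nonneg (by linarith [(hη01 n τ).2]) (hηT01 τ).1
  have hθle : ∀ n τ, θ n τ ≤ 1 := fun n τ => by
    calc θ n τ = (1 - η n τ) * ηT τ := rfl
      _ ≤ 1 * 1 := mul_le_mul (by linarith [(hη01 n τ).1]) (hηT01 τ).2 (hηT01 τ).1 zero_le_one
      _ = 1 := one_mul 1
  -- below `b'`: `θₙ = 1 - ηₙ` and `θₙ' = kₙ`
  have hθeq : ∀ n τ, τ < b' → θ n τ = 1 - η n τ := fun n τ hτ => by
    simp only [hθ, hηT1' τ hτ.le, mul_one]
  have hθ'eq : ∀ n τ, τ < b' → θ' n τ = k n τ := fun n τ hτ => by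
    simp only [hθ', hηT1' τ hτ.le, hkT0 τ hτ, mul_one, neg_zero, mul_zero, add_zero]
  have hIccn : ∀ n, Icc (s₀ - 2 * ε n) b'' ⊆ Ioo a b := fun n τ hτ =>
    ⟨by linarith [hτ.1, hεle n], hτ.2.trans_lt hb''b⟩
  set ζ : ℕ → ℝ → E → ℝ := fun n τ x => θ n τ * φ x with hζ
  have hζtest : ∀ n, IsSpaceTimeTestOn Q (ζ n) := fun n =>
    isSpaceTimeTestOn_mul hab (hθs n) (hIccn n) (hθ0 n) hφ hφc
  have hζ0 : ∀ n τ x, 0 ≤ ζ n τ x := fun n τ x => mul_nonneg (hθnn n τ) (hφ0 x)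
  -- ## the sliced inequalities, for all `n`, at a.e. `t`
  have hae := ae_all_iff.2 fun n => hs.ae_localEnergy_slice hG₀ hu3 hfu (hζtest n) (hζ0 n)
  filter_upwards [hae] with t ht htI
  obtain ⟨hs₀t, htb'⟩ := htI
  -- ### pointwise calculus of `ζₙ` below `b'`
  have hTD : ∀ n (z : ℝ × E), z.1 < b' → timeDeriv (ζ n) z.1 z.2 = k n z.1 * φ z.2 := by
    intro n z hz
    have hd : HasDerivAt (fun σ => ζ n σ z.2) (θ' n z.1 * φ z.2) z.1 := (hθd n z.1).mul_const _
    rw [timeDeriv, hd.deriv, hθ'eq n z.1 hz]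
  have hLap : ∀ n (z : ℝ × E), Δ (ζ n z.1) z.2 = θ n z.1 * Δ φ z.2 := by
    intro n z
    have e : ζ n z.1 = (θ n z.1) • φ := by
      funext y; simp only [hζ, Pi.smul_apply, smul_eq_mul]
    rw [e, InnerProductSpace.laplacian_smul _ hφ2.contDiffAt, smul_eq_mul]
  have hgr : ∀ n (z : ℝ × E), gradient (ζ n z.1) z.2 = θ n z.1 • gradient φ z.2 := by
    intro n z
    have hd : DifferentiableAt ℝ φ z.2 := (hφ.differentiable (by simp)).differentiableAt
    show gradient (fun y => θ n z.1 * φ y) z.2 = _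
    rw [gradient, gradient, fderiv_const_mul hd, map_smul]
  -- the right-hand integrand of the sliced inequality, below `b'`
  have hRHS : ∀ n (z : ℝ × E), z.1 < b' →
      ‖u z.1 z.2‖ ^ 2 * (timeDeriv (ζ n) z.1 z.2 + ν * Δ (ζ n z.1) z.2) +
        (‖u z.1 z.2‖ ^ 2 + 2 * p z.1 z.2) * ⟪u z.1 z.2, gradient (ζ n z.1) z.2⟫ +
        2 * ⟪(0 : ℝ → E → E) z.1 z.2, u z.1 z.2⟫ * ζ n z.1 z.2 =
      k n z.1 * F z + (1 - η n z.1) * R z := by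
    intro n z hz
    rw [hTD n z hz, hLap n z, hgr n z, hθeq n z.1 hz]
    simp only [hF, hR, Pi.zero_apply, inner_zero_left, mul_zero, zero_mul, add_zero,
      real_inner_smul_right]
    ring
  -- localisation to `K`: for `z.1 < t`, `kₙ F = kₙ W` and `(1 - ηₙ) R = (1 - ηₙ) RK`
  have hkW : ∀ n (z : ℝ × E), k n z.1 * F z = k n z.1 * W z := by
    intro n z
    by_cases hkz : k n z.1 = 0
    · rw [hkz, zero_mul, zero_mul]
    · have hz1 := hks n z.1 hkz
      rw [hWF z ⟨by linarith [hz1.1, hεle n], by linarith [hz1.2, hεpos n]⟩]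
  have hηRK : ∀ n (z : ℝ × E), z.1 < t → (1 - η n z.1) * R z = (1 - η n z.1) * RK z := by
    intro n z hz
    by_cases h1 : z.1 ≤ s₀ - 2 * ε n
    · rw [hη1 n z.1 h1, sub_self, zero_mul, zero_mul]
    · rw [hRKR z ⟨by linarith [not_le.1 h1, hεle n], by linarith⟩]
  -- ### the inequality `(*ₙ)`: `∫ |u(t)|² φ ≤ ∫ kₙ U + ∫_{τ<t} (1 - ηₙ) RK`
  have hint_kW : ∀ n, Integrable (fun z : ℝ × E => k n z.1 * W z) (volume : Measure (ℝ × E)) :=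
    fun n => hIW.bdd_mul ((hkc n).comp continuous_fst).aestronglyMeasurable
      (Eventually.of_forall fun z => by rw [Real.norm_eq_abs]; exact hkb n z.1)
  have hηc : ∀ n, Continuous fun z : ℝ × E => 1 - η n z.1 := fun n =>
    continuous_const.sub ((hηs n).continuous.comp continuous_fst)
  have hηb : ∀ n (z : ℝ × E), ‖1 - η n z.1‖ ≤ 1 := fun n z => by
    rw [Real.norm_eq_abs, abs_of_nonneg (by linarith [(hη01 n z.1).2])]
    linarith [(hη01 n z.1).1]
  have hint_ηR : ∀ n, Integrable (fun z : ℝ × E => (1 - η n z.1) * RK z) (volume : Measure (ℝ × E)) :=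
    fun n => hIRK.bdd_mul (hηc n).aestronglyMeasurable (Eventually.of_forall (hηb n))
  have hstep : ∀ n, ∫ x, ‖u t x‖ ^ 2 * φ x ≤
      (∫ τ, k n τ * U τ) + ∫ z in {z : ℝ × E | z.1 < t}, (1 - η n z.1) * RK z := by
    intro n
    have hL := ht n
    -- the slice term: `ζₙ(t, ·) = φ`
    have hζt : ∀ x, ζ n t x = φ x := fun x => by
      simp only [hζ, hθeq n t htb', hη0 n t (by linarith [hεpos n]), sub_zero, one_mul]
    have e1 : (∫ x, ‖u t x‖ ^ 2 * ζ n t x) = ∫ x, ‖u t x‖ ^ 2 * φ x := by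
      simp only [hζt]
    -- the dissipation term is nonnegative
    have e2 : 0 ≤ 2 * ν * ∫ z in {z : ℝ × E | z.1 < t},
        frobeniusNormSq (G₀ z.1 z.2) * ζ n z.1 z.2 :=
      mul_nonneg (by positivity) (setIntegral_nonneg (hmeasS t) fun z _ =>
        mul_nonneg (frobeniusNormSq_nonneg _) (hζ0 n z.1 z.2))
    -- the right-hand side
    have e3 : ∫ z in {z : ℝ × E | z.1 < t},
        (‖u z.1 z.2‖ ^ 2 * (timeDeriv (ζ n) z.1 z.2 + ν * Δ (ζ n z.1) z.2) +
          (‖u z.1 z.2‖ ^ 2 + 2 * p z.1 z.2) * ⟪u z.1 z.2, gradient (ζ n z.1) z.2⟫ +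
          2 * ⟪(0 : ℝ → E → E) z.1 z.2, u z.1 z.2⟫ * ζ n z.1 z.2) =
        (∫ z in {z : ℝ × E | z.1 < t}, k n z.1 * W z) +
          ∫ z in {z : ℝ × E | z.1 < t}, (1 - η n z.1) * RK z := by
      rw [← integral_add (hint_kW n).integrableOn (hint_ηR n).integrableOn]
      refine setIntegral_congr_fun (hmeasS t) fun z hz => ?_
      have hz' : z.1 < t := hz
      rw [hRHS n z (hz'.trans htb'), hkW n z, hηRK n z hz']
    -- `∫_{τ<t} kₙ W = ∫ kₙ W = ∫ kₙ U`
    have e4 : ∫ z in {z : ℝ × E | z.1 < t}, k n z.1 * W z = ∫ τ, k n τ * U τ := by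
      rw [setIntegral_eq_integral_of_forall_compl_eq_zero (fun z hz => ?_)]
      · rw [Measure.volume_eq_prod, integral_prod _ (hint_kW n)]
        refine integral_congr_ae (Eventually.of_forall fun τ => ?_)
        simp only [hU, ← integral_const_mul]
      · have hz' : t ≤ z.1 := not_lt.1 hz
        rw [hk0 n z.1 (fun h => by linarith [h.2, hεpos n]), zero_mul]
    rw [e1, e3, e4] at hL
    linarith
  -- ### the limits as `n → ∞`
  have hlimU : Tendsto (fun n => ∫ τ, k n τ * U τ) atTop (𝓝 (U s₀)) :=
    tendsto_integral_kernel_mul_of_lebesguePoint hIU (fun w δ hδ hm => hs₀L w δ hδ hm) hεpos hε0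
      hkc hkb hks hk1
  have hUs₀ : U s₀ = ∫ x, ‖u s₀ x‖ ^ 2 * φ x := hUeq s₀ ⟨hs₀a.le, by linarith⟩
  -- `(1 - ηₙ(τ)) → 1_{s₀ ≤ τ}`
  have hlimR : Tendsto (fun n => ∫ z in {z : ℝ × E | z.1 < t}, (1 - η n z.1) * RK z) atTop
      (𝓝 (∫ z in {z : ℝ × E | z.1 < t}, ({z : ℝ × E | s₀ ≤ z.1}).indicator RK z)) := by
    refine tendsto_integral_of_dominated_convergence (fun z => ‖RK z‖)
      (fun n => (hint_ηR n).aestronglyMeasurable.restrict) hIRK.norm.restrict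
      (fun n => Eventually.of_forall fun z => ?_) (Eventually.of_forall fun z => ?_)
    · rw [norm_mul]
      exact mul_le_of_le_one_left (norm_nonneg _) (hηb n z)
    · have h1 := tendsto_cutoff_indicator hεpos hε0 (hη1) (hη0) z.1
      have h2 : Tendsto (fun n => (1 - η n z.1) * RK z) atTop
          (𝓝 ((1 - (Iio s₀).indicator (fun _ => (1 : ℝ)) z.1) * RK z)) :=
        (tendsto_const_nhds.sub h1).mul_const _
      refine h2.trans (le_of_eq ?_)
      congr 1
      by_cases hz : s₀ ≤ z.1
      · rw [indicator_of_notMem (fun h' => not_lt.2 hz (mem_Iio.1 h')),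
          indicator_of_mem (show z ∈ {z : ℝ × E | s₀ ≤ z.1} from hz), sub_zero, one_mul]
      · rw [indicator_of_mem (mem_Iio.2 (not_le.1 hz)),
          indicator_of_notMem (show z ∉ {z : ℝ × E | s₀ ≤ z.1} from hz), sub_self, zero_mul]
  -- the limit set integral is the integral over `[s₀, t) × E`
  have hlimR' : ∫ z in {z : ℝ × E | z.1 < t}, ({z : ℝ × E | s₀ ≤ z.1}).indicator RK z =
      ∫ z in Ico s₀ t ×ˢ (univ : Set E), R z := by
    have hmeas' : MeasurableSet {z : ℝ × E | s₀ ≤ z.1} := measurableSet_le measurable_const measurable_fst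
    rw [integral_indicator hmeas', Measure.restrict_restrict hmeas']
    have hset : {z : ℝ × E | s₀ ≤ z.1} ∩ {z : ℝ × E | z.1 < t} = Ico s₀ t ×ˢ (univ : Set E) := by
      ext z
      simp only [mem_inter_iff, mem_setOf_eq, mem_prod, mem_Ico, mem_univ, and_true]
    rw [hset]
    refine setIntegral_congr_fun (measurableSet_Ico.prod MeasurableSet.univ) fun z hz => ?_
    exact hRKR z ⟨by linarith [(mem_prod.1 hz).1.1], by linarith [(mem_prod.1 hz).1.2]⟩
  -- ### pass to the limit in `(*ₙ)`
  have hfin := le_of_tendsto_of_tendsto' tendsto_const_nhds (hlimU.add hlimR) hstep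
  rw [hUs₀, hlimR'] at hfin
  exact hfin

/-- **Local energy bound on balls, a.e. in time, on compact time windows**: for a suitable weak
solution on `Q ⊇ (a, b) × E` and `a < a'`, `b' < b`, `∫_{B(0,r)} |u(t)|² ≤ C` for a.e.
`t ∈ (a', b')` (the energy class of the structure on the compact box `[a', b'] × B̄(0, r)`).
[folklore] -/
theorem exists_ae_lintegral_ball_sq_le (hs : IsSuitableWeakSolutionOn Q ν 0 u p)
    {a b : ℝ} (hab : Ioo a b ×ˢ (univ : Set E) ⊆ (Q : Set (ℝ × E))) {a' b' : ℝ} (ha' : a < a')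
    (hb' : b' < b) (r : ℝ) :
    ∃ C : ℝ≥0, ∀ᵐ t ∂(volume.restrict (Ioo a' b')), ∫⁻ x in ball (0 : E) r, ‖u t x‖ₑ ^ 2 ≤ C := by
  set K : Set (ℝ × E) := Icc a' b' ×ˢ closedBall (0 : E) r with hK
  have hKc : IsCompact K := isCompact_Icc.prod (isCompact_closedBall _ _)
  have hI : Icc a' b' ⊆ Ioo a b := fun t ht => ⟨ha'.trans_le ht.1, ht.2.trans_lt hb'⟩
  have hKQ : K ⊆ (Q : Set (ℝ × E)) := (prod_mono hI (subset_univ _)).trans hab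
  obtain ⟨C, hC⟩ := hs.energyClass K hKQ hKc
  refine ⟨C, ?_⟩
  have hC' : ∀ᵐ t ∂(volume.restrict (Ioo a' b')),
      ∫⁻ x, K.indicator (fun w : ℝ × E => ‖u w.1 w.2‖ₑ ^ 2) (t, x) ≤ C := ae_restrict_of_ae hC
  filter_upwards [hC', ae_restrict_mem measurableSet_Ioo] with t ht htI
  refine le_trans ?_ ht
  rw [← lintegral_indicator measurableSet_ball]
  refine lintegral_mono fun x => ?_
  by_cases hx : x ∈ ball (0 : E) r
  · rw [indicator_of_mem hx, indicator_of_mem (show (t, x) ∈ K from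
      mem_prod.2 ⟨Ioo_subset_Icc_self htI, ball_subset_closedBall hx⟩)]
  · rw [indicator_of_notMem hx]
    exact bot_le

/-- The pressure of a suitable weak solution on `Q ⊇ (a, b) × E` lies in `L^{3/2}((a', b') × B(0, r))`
for `a < a'`, `b' < b`. [folklore] -/
theorem lintegral_pressure_lt_top (hs : IsSuitableWeakSolutionOn Q ν 0 u p)
    {a b : ℝ} (hab : Ioo a b ×ˢ (univ : Set E) ⊆ (Q : Set (ℝ × E))) {a' b' : ℝ} (ha' : a < a')
    (hb' : b' < b) (r : ℝ) :
    ∫⁻ z in Ioo a' b' ×ˢ ball (0 : E) r, ‖p z.1 z.2‖ₑ ^ (3 / 2 : ℝ) < ∞ := by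
  set K : Set (ℝ × E) := Icc a' b' ×ˢ closedBall (0 : E) r with hK
  have hKc : IsCompact K := isCompact_Icc.prod (isCompact_closedBall _ _)
  have hI : Icc a' b' ⊆ Ioo a b := fun t ht => ⟨ha'.trans_le ht.1, ht.2.trans_lt hb'⟩
  have hKQ : K ⊆ (Q : Set (ℝ × E)) := (prod_mono hI (subset_univ _)).trans hab
  exact (lintegral_mono_set (Set.prod_mono Ioo_subset_Icc_self ball_subset_closedBall)).trans_lt
    (hs.pressure K hKQ hKc)

/-- **The remainder of the local energy inequality vanishes as `t ↓ s₀`**: for `R` integrable on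
`[s₀, c] × E` (`s₀ < c`), `∫_{[s₀,t) × E} R → 0` as `t → s₀⁺` (dominated convergence along
sequences; the slice `{s₀} × E` is null). [folklore] -/
theorem tendsto_setIntegral_Ico_prod {R : ℝ × E → ℝ} {s₀ c : ℝ} (hc : s₀ < c)
    (hR : IntegrableOn R (Icc s₀ c ×ˢ (univ : Set E)) volume) :
    Tendsto (fun t => ∫ z in Ico s₀ t ×ˢ (univ : Set E), R z) (𝓝[>] s₀) (𝓝 0) := by
  set RK : ℝ × E → ℝ := (Icc s₀ c ×ˢ (univ : Set E)).indicator R with hRK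
  have hmK : MeasurableSet (Icc s₀ c ×ˢ (univ : Set E)) := measurableSet_Icc.prod MeasurableSet.univ
  have hIRK : Integrable RK (volume : Measure (ℝ × E)) := hR.integrable_indicator hmK
  have hmA : ∀ t, MeasurableSet (Ico s₀ t ×ˢ (univ : Set E)) := fun t =>
    measurableSet_Ico.prod MeasurableSet.univ
  -- for `t ≤ c` the set integral is `∫ 1_{[s₀,t)×E} RK`
  have heq : ∀ t, t ≤ c → ∫ z in Ico s₀ t ×ˢ (univ : Set E), R z =
      ∫ z, (Ico s₀ t ×ˢ (univ : Set E)).indicator RK z := by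
    intro t ht
    rw [integral_indicator (hmA t)]
    refine setIntegral_congr_fun (hmA t) fun z hz => ?_
    rw [hRK, indicator_of_mem]
    exact mem_prod.2 ⟨Ico_subset_Icc_self.trans (Icc_subset_Icc_right ht) (mem_prod.1 hz).1, mem_univ _⟩
  rw [tendsto_iff_seq_tendsto]
  intro t ht
  have ht' : Tendsto t atTop (𝓝 s₀) := tendsto_nhdsWithin_iff.1 ht |>.1
  have htpos : ∀ᶠ j in atTop, t j ∈ Ioi s₀ := (tendsto_nhdsWithin_iff.1 ht).2
  have htc : ∀ᶠ j in atTop, t j ≤ c :=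
    (ht'.eventually (Iic_mem_nhds hc)).mono fun j hj => hj
  -- dominated convergence
  have hlim : Tendsto (fun j => ∫ z, (Ico s₀ (t j) ×ˢ (univ : Set E)).indicator RK z) atTop (𝓝 (∫ z : ℝ × E, (0 : ℝ))) := by
    refine tendsto_integral_of_dominated_convergence (fun z => ‖RK z‖)
      (fun j => (hIRK.indicator (hmA _)).aestronglyMeasurable) hIRK.norm
      (fun j => Eventually.of_forall fun z => norm_indicator_le_norm_self _ _) ?_
    -- a.e. pointwise: off the null slice `{z.1 = s₀}` the indicators are eventually zero
    have hnull : ∀ᵐ z : ℝ × E ∂volume, z.1 ≠ s₀ := by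
      have h0 : (volume : Measure (ℝ × E)) ({s₀} ×ˢ (univ : Set E)) = 0 := by
        rw [Measure.volume_eq_prod, Measure.prod_prod, Real.volume_singleton, zero_mul]
      rw [ae_iff]
      refine measure_mono_null (fun z hz => ?_) h0
      simp only [ne_eq, mem_setOf_eq, not_not] at hz
      exact mem_prod.2 ⟨hz, mem_univ _⟩
    filter_upwards [hnull] with z hz
    rcases lt_or_gt_of_ne hz with h | h
    · refine tendsto_const_nhds.congr fun j => ?_
      show (0 : ℝ) = (Ico s₀ (t j) ×ˢ (univ : Set E)).indicator RK z
      rw [indicator_of_notMem]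
      exact fun hz' => not_le.2 h (mem_prod.1 hz').1.1
    · have hev : ∀ᶠ j in atTop, t j < z.1 := (ht'.eventually (Iio_mem_nhds h)).mono fun j hj => hj
      refine tendsto_const_nhds.congr' (hev.mono fun j hj => ?_)
      show (0 : ℝ) = (Ico s₀ (t j) ×ˢ (univ : Set E)).indicator RK z
      rw [indicator_of_notMem]
      exact fun hz' => not_lt.2 (mem_prod.1 hz').1.2.le hj
  rw [integral_zero] at hlim
  refine hlim.congr' ?_
  filter_upwards [htc] with j hj
  exact (heq (t j) hj).symm

end Start

/-! ### The Hilbert-space step: strong convergence from energy control and weak convergence -/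

section Core

variable {α : Type*} [MeasurableSpace α] {μ : Measure α}
  {F : Type*} [NormedAddCommGroup F] [InnerProductSpace ℝ F]

/-- **Strong `L²` convergence from energy control and weak convergence** (the elementary
Hilbert-space step behind the strong continuity of Leray–Hopf / local energy solutions at times of
energy continuity; Lemarié-Rieusset 2016, Prop. 14.1; Seregin 2014, Remark B.4). Let `v s₀`
and the slices `v t`, `t ∈ S`, lie in `L²(μ)` with a common bound, let the pairings of `v t` with
a family `ψ i` dense in `L²(μ)` converge to those of `v s₀` along `S`, and let the weighted energies
satisfy `limsup ∫ |v t|² φ ≤ ∫ |v s₀|² φ` for a weight `0 ≤ φ ≤ 1`. Then `∫ |v t − v s₀|² φ → 0`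
along `S`. [folklore] -/
theorem tendsto_integral_norm_sub_sq_mul {v : ℝ → α → F} {S : Set ℝ} {s₀ : ℝ} {l : Filter ℝ}
    (hl : l ≤ 𝓟 S) {M : ℝ} (hM : 0 ≤ M)
    (hv : ∀ t ∈ S, MemLp (v t) 2 μ) (hv₀ : MemLp (v s₀) 2 μ)
    (hvb : ∀ t ∈ S, (eLpNorm (v t) 2 μ).toReal ≤ M) (hv₀b : (eLpNorm (v s₀) 2 μ).toReal ≤ M)
    {φ : α → ℝ} (hφm : AEStronglyMeasurable φ μ) (hφ0 : ∀ x, 0 ≤ φ x) (hφ1 : ∀ x, φ x ≤ 1)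
    {ψ : ℕ → α → F} (hψ : ∀ i, MemLp (ψ i) 2 μ)
    (hψd : ∀ g : α → F, MemLp g 2 μ → ∀ ε : ℝ, 0 < ε → ∃ i, (eLpNorm (g - ψ i) 2 μ).toReal ≤ ε)
    (hpair : ∀ i, Tendsto (fun t => ∫ x, ⟪v t x, ψ i x⟫ ∂μ) l (𝓝 (∫ x, ⟪v s₀ x, ψ i x⟫ ∂μ)))
    (hen : ∀ ε : ℝ, 0 < ε → ∀ᶠ t in l,
      ∫ x, ‖v t x‖ ^ 2 * φ x ∂μ ≤ (∫ x, ‖v s₀ x‖ ^ 2 * φ x ∂μ) + ε) :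
    Tendsto (fun t => ∫ x, ‖v t x - v s₀ x‖ ^ 2 * φ x ∂μ) l (𝓝 0) := by
  set D : α → F := v s₀ with hD
  set g : α → F := fun x => φ x • D x with hg
  have hφb : ∀ x, ‖φ x‖ ≤ 1 := fun x => by
    rw [Real.norm_eq_abs, abs_of_nonneg (hφ0 x)]; exact hφ1 x
  have hgm : MemLp g 2 μ := by
    refine MemLp.of_le hv₀ (hφm.smul hv₀.1) (Eventually.of_forall fun x => ?_)
    rw [hg, norm_smul]
    exact mul_le_of_le_one_left (norm_nonneg _) (hφb x)
  -- integrability of the pieces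
  have hsq : ∀ {f : α → F}, MemLp f 2 μ → Integrable (fun x => ‖f x‖ ^ 2 * φ x) μ := by
    intro f hf
    have h1 : Integrable (fun x => ‖f x‖ ^ 2) μ := (memLp_two_iff_integrable_sq_norm hf.1).1 hf
    exact (h1.bdd_mul hφm (Eventually.of_forall hφb)).congr
      (Eventually.of_forall fun x => mul_comm _ _)
  have hStep : ∀ t ∈ S, ∀ i,
      ∫ x, ‖v t x - D x‖ ^ 2 * φ x ∂μ ≤
        ((∫ x, ‖v t x‖ ^ 2 * φ x ∂μ) - ∫ x, ‖D x‖ ^ 2 * φ x ∂μ) +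
          2 * |(∫ x, ⟪v t x, ψ i x⟫ ∂μ) - ∫ x, ⟪D x, ψ i x⟫ ∂μ| +
          2 * (2 * M) * (eLpNorm (g - ψ i) 2 μ).toReal := by
    intro t ht i
    have hvt := hv t ht
    -- the algebraic identity, integrated
    have hI1 : Integrable (fun x => ‖v t x‖ ^ 2 * φ x) μ := hsq hvt
    have hI2 : Integrable (fun x => ‖D x‖ ^ 2 * φ x) μ := hsq hv₀
    have hI3 : Integrable (fun x => ⟪v t x, g x⟫) μ := integrable_real_inner_of_memLp_two hvt hgm
    have hI4 : Integrable (fun x => ⟪D x, g x⟫) μ := integrable_real_inner_of_memLp_two hv₀ hgm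
    have e1 : ∫ x, ‖v t x - D x‖ ^ 2 * φ x ∂μ =
        (∫ x, ‖v t x‖ ^ 2 * φ x ∂μ) + (∫ x, ‖D x‖ ^ 2 * φ x ∂μ) - 2 * ∫ x, ⟪v t x, g x⟫ ∂μ := by
      have ef : (fun x => ‖v t x - D x‖ ^ 2 * φ x) =
          fun x => (‖v t x‖ ^ 2 * φ x + ‖D x‖ ^ 2 * φ x) - 2 * ⟪v t x, g x⟫ := by
        funext x
        simp only [hg, real_inner_smul_right]
        rw [@norm_sub_sq_real]
        ring
      have hI12 : Integrable (fun x => ‖v t x‖ ^ 2 * φ x + ‖D x‖ ^ 2 * φ x) μ := hI1.add hI2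
      rw [ef, integral_sub hI12 (hI3.const_mul 2), integral_add hI1 hI2, integral_const_mul]
    have e2 : ∫ x, ‖D x‖ ^ 2 * φ x ∂μ = ∫ x, ⟪D x, g x⟫ ∂μ := by
      refine integral_congr_ae (Eventually.of_forall fun x => ?_)
      simp only [hg, real_inner_smul_right, real_inner_self_eq_norm_sq]
      ring
    -- the cross term through `ψ i`
    have hI5 : Integrable (fun x => ⟪v t x - D x, ψ i x⟫) μ :=
      integrable_real_inner_of_memLp_two (hvt.sub hv₀) (hψ i)
    have hI6 : Integrable (fun x => ⟪v t x - D x, g x - ψ i x⟫) μ :=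
      integrable_real_inner_of_memLp_two (hvt.sub hv₀) (hgm.sub (hψ i))
    have e3 : (∫ x, ⟪v t x, g x⟫ ∂μ) - ∫ x, ⟪D x, g x⟫ ∂μ =
        (∫ x, ⟪v t x - D x, ψ i x⟫ ∂μ) + ∫ x, ⟪v t x - D x, g x - ψ i x⟫ ∂μ := by
      rw [← integral_sub hI3 hI4, ← integral_add hI5 hI6]
      refine integral_congr_ae (Eventually.of_forall fun x => ?_)
      simp only [inner_sub_left, inner_sub_right]
      ring
    have e4 : ∫ x, ⟪v t x - D x, ψ i x⟫ ∂μ = (∫ x, ⟪v t x, ψ i x⟫ ∂μ) - ∫ x, ⟪D x, ψ i x⟫ ∂μ := by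
      rw [← integral_sub (integrable_real_inner_of_memLp_two hvt (hψ i))
        (integrable_real_inner_of_memLp_two hv₀ (hψ i))]
      refine integral_congr_ae (Eventually.of_forall fun x => ?_)
      simp only [inner_sub_left]
    -- Cauchy–Schwarz on the remainder
    have hCS : |∫ x, ⟪v t x - D x, g x - ψ i x⟫ ∂μ| ≤ (2 * M) * (eLpNorm (g - ψ i) 2 μ).toReal := by
      refine (abs_integral_inner_le_of_memLp_two (hvt.sub hv₀) (hgm.sub (hψ i))).trans ?_
      refine mul_le_mul_of_nonneg_right ?_ ENNReal.toReal_nonneg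
      have h1 : eLpNorm (v t - D) 2 μ ≤ eLpNorm (v t) 2 μ + eLpNorm D 2 μ :=
        eLpNorm_sub_le hvt.1 hv₀.1 (by norm_num)
      calc (eLpNorm (fun x => v t x - D x) 2 μ).toReal = (eLpNorm (v t - D) 2 μ).toReal := rfl
        _ ≤ (eLpNorm (v t) 2 μ + eLpNorm D 2 μ).toReal :=
            ENNReal.toReal_mono (ENNReal.add_ne_top.2 ⟨hvt.2.ne, hv₀.2.ne⟩) h1
        _ = (eLpNorm (v t) 2 μ).toReal + (eLpNorm D 2 μ).toReal :=
            ENNReal.toReal_add hvt.2.ne hv₀.2.ne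
        _ ≤ M + M := add_le_add (hvb t ht) hv₀b
        _ = 2 * M := by ring
    rw [e1, e2]
    have key : -(2 * ((∫ x, ⟪v t x, g x⟫ ∂μ) - ∫ x, ⟪D x, g x⟫ ∂μ)) ≤
        2 * |(∫ x, ⟪v t x, ψ i x⟫ ∂μ) - ∫ x, ⟪D x, ψ i x⟫ ∂μ| +
          2 * (2 * M) * (eLpNorm (g - ψ i) 2 μ).toReal := by
      rw [e3, e4]
      have ha := neg_abs_le ((∫ x, ⟪v t x, ψ i x⟫ ∂μ) - ∫ x, ⟪D x, ψ i x⟫ ∂μ)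
      have hb := neg_abs_le (∫ x, ⟪v t x - D x, g x - ψ i x⟫ ∂μ)
      nlinarith
    linarith
  -- ## the `ε`-argument
  have hnn : ∀ t, 0 ≤ ∫ x, ‖v t x - D x‖ ^ 2 * φ x ∂μ := fun t =>
    integral_nonneg fun x => mul_nonneg (sq_nonneg _) (hφ0 x)
  rw [Metric.tendsto_nhds]
  intro ε hε
  set δ : ℝ := ε / (16 * (M + 1)) with hδ
  have hδpos : 0 < δ := by positivity
  obtain ⟨i, hi⟩ := hψd g hgm δ hδpos
  have h1 : ∀ᶠ t in l, |(∫ x, ⟪v t x, ψ i x⟫ ∂μ) - ∫ x, ⟪D x, ψ i x⟫ ∂μ| < ε / 8 := by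
    have := (hpair i)
    rw [Metric.tendsto_nhds] at this
    exact this (ε / 8) (by positivity)
  have h2 := hen (ε / 8) (by positivity)
  have h3 : ∀ᶠ t in l, t ∈ S := hl (mem_principal_self S)
  filter_upwards [h1, h2, h3] with t ht1 ht2 ht3
  rw [Real.dist_eq, sub_zero, abs_of_nonneg (hnn t)]
  have h := hStep t ht3 i
  have hMδ : 2 * (2 * M) * (eLpNorm (g - ψ i) 2 μ).toReal ≤ ε / 4 := by
    calc 2 * (2 * M) * (eLpNorm (g - ψ i) 2 μ).toReal ≤ 2 * (2 * M) * δ :=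
          mul_le_mul_of_nonneg_left hi (by positivity)
      _ = ε * (M / (4 * (M + 1))) := by rw [hδ]; field_simp; ring
      _ ≤ ε * (1 / 4) := by
          refine mul_le_mul_of_nonneg_left ?_ hε.le
          rw [div_le_div_iff₀ (by positivity) (by norm_num)]
          nlinarith
      _ = ε / 4 := by ring
  linarith

end Core

/-! ### Suitable weak solutions on slabs of `ℝ × ℝ³`: pairings and strong right-continuity -/

section Slab

variable {Q : Opens (ℝ × EuclideanSpace ℝ (Fin 3))}
  {u : ℝ → EuclideanSpace ℝ (Fin 3) → EuclideanSpace ℝ (Fin 3)}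
  {p : ℝ → EuclideanSpace ℝ (Fin 3) → ℝ}

/-- **Continuity of the pairings along a set of full measure** (Robinson–Rodrigo–Sadowski 2016,
Lemma 13.8; Temam 1977, Ch. III Lemma 1.1: the weak time regularity of weak solutions). For a
suitable weak solution (viscosity `1`, no force) on `Q ⊇ (a, b) × ℝ³`, `a < a'`, `b' < b`, and a
test field `ψ` supported in `B(0, r)`, there is a set `S` of full measure in `(a', b')` such that
`t ↦ ∫_{B(0,r)} ⟪u(t), ψ⟫` is continuous on `S` (the tree's modulus
`NSCylinder.exists_fullMeasure_pairing_modulus` on the cylinder `(a', b') × B(0, r)`).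
[cite: RobinsonRodrigoSadowski2016, §13.5 Lemma 13.8] -/
theorem exists_fullMeasure_tendsto_pairing (hs : IsSuitableWeakSolutionOn Q 1 0 u p)
    {a b : ℝ} (hab : Ioo a b ×ˢ (univ : Set (EuclideanSpace ℝ (Fin 3))) ⊆ (Q : Set _))
    {a' b' : ℝ} (ha' : a < a') (hb' : b' < b) {r : ℝ} {ψ : EuclideanSpace ℝ (Fin 3) → EuclideanSpace ℝ (Fin 3)}
    (hψ : FunctionSpaces.IsTestFunctionOn
      (⟨ball (0 : EuclideanSpace ℝ (Fin 3)) r, isOpen_ball⟩ : Opens (EuclideanSpace ℝ (Fin 3))) ψ) :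
    ∃ S : Set ℝ, (∀ᵐ t ∂(volume.restrict (Ioo a' b')), t ∈ S) ∧
      ∀ s ∈ S, Tendsto (fun t => ∫ x in ball (0 : EuclideanSpace ℝ (Fin 3)) r, ⟪u t x, ψ x⟫) (𝓝[S] s)
        (𝓝 (∫ x in ball (0 : EuclideanSpace ℝ (Fin 3)) r, ⟪u s x, ψ x⟫)) := by
  set Ω : Opens (EuclideanSpace ℝ (Fin 3)) := ⟨ball (0 : EuclideanSpace ℝ (Fin 3)) r, isOpen_ball⟩ with hΩ
  have hbΩ : Bornology.IsBounded (Ω : Set (EuclideanSpace ℝ (Fin 3))) := isBounded_ball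
  have hle : timeCylinder Ω a' b' ≤ Q := by
    intro z hz
    have hz' : z ∈ Ioo a' b' ×ˢ ball (0 : EuclideanSpace ℝ (Fin 3)) r := hz
    exact hab (mem_prod.2 ⟨⟨ha'.trans (mem_prod.1 hz').1.1, (mem_prod.1 hz').1.2.trans hb'⟩, mem_univ _⟩)
  have hsol : IsDistributionalNSSolutionOn (timeCylinder Ω a' b') 1 0 u p :=
    hs.distributional.of_le hle
  obtain ⟨C, hC⟩ := exists_ae_lintegral_ball_sq_le hs hab ha' hb' r
  have hP := lintegral_pressure_lt_top hs hab ha' hb' r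
  obtain ⟨K₀, K₁, K₂, -, hK₁, hK₂⟩ := exists_bounds_of_isTestFunctionOn hψ
  obtain ⟨S, hS, hmod⟩ := NSCylinder.exists_fullMeasure_pairing_modulus hsol hbΩ
    (C := (C : ℝ≥0∞)) ENNReal.coe_ne_top hP.ne hC le_rfl hψ hK₁ hK₂
  refine ⟨S, hS, fun s hsS => ?_⟩
  have hω : ∃ A B : ℝ, ∀ t ∈ S, ∀ s' ∈ S,
      |(∫ x in (Ω : Set (EuclideanSpace ℝ (Fin 3))), ⟪u t x, ψ x⟫) -
        ∫ x in (Ω : Set (EuclideanSpace ℝ (Fin 3))), ⟪u s' x, ψ x⟫| ≤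
        A * |t - s'| + B * |t - s'| ^ (1 / 3 : ℝ) := ⟨_, _, hmod⟩
  obtain ⟨A, B, hAB⟩ := hω
  have hlim : Tendsto (fun d : ℝ => A * d + B * d ^ (1 / 3 : ℝ)) (𝓝 0) (𝓝 0) := by
    have h1 : Tendsto (fun d : ℝ => A * d + B * d ^ (1 / 3 : ℝ)) (𝓝 0)
        (𝓝 (A * 0 + B * (0 : ℝ) ^ (1 / 3 : ℝ))) :=
      ((continuous_const.mul continuous_id).add (continuous_const.mul
        (continuous_id.rpow_const fun _ => Or.inr (by norm_num)))).tendsto 0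
    rwa [Real.zero_rpow (by norm_num), mul_zero, mul_zero, add_zero] at h1
  rw [Metric.tendsto_nhdsWithin_nhds]
  intro ε hε
  obtain ⟨δ, hδ, hδε⟩ := Metric.tendsto_nhds_nhds.1 hlim ε hε
  refine ⟨δ, hδ, fun {t} htS hts => ?_⟩
  rw [Real.dist_eq]
  have h1 := hAB t htS s hsS
  have h2 : dist (|t - s|) 0 < δ := by
    rw [Real.dist_eq, sub_zero, abs_abs, ← Real.dist_eq]; exact hts
  have h3 := hδε h2
  rw [Real.dist_eq, sub_zero] at h3
  exact h1.trans_lt (lt_of_abs_lt h3)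

/-- **The good times of a suitable weak solution on a compact window** (bookkeeping): a set `S`
of full measure in `(a', b')` on which every slice is measurable, the local energies on the balls
`B(0, m+3)` are bounded by constants `C m`, and the pairings against countably many given test
fields are continuous along `S`. [folklore] -/
theorem exists_goodSet (hs : IsSuitableWeakSolutionOn Q 1 0 u p)
    {a b : ℝ} (hab : Ioo a b ×ˢ (univ : Set (EuclideanSpace ℝ (Fin 3))) ⊆ (Q : Set _))
    {a' b' : ℝ} (ha' : a < a') (hb' : b' < b)
    (ψ : ℕ → ℕ → EuclideanSpace ℝ (Fin 3) → EuclideanSpace ℝ (Fin 3))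
    (hψ : ∀ m i : ℕ, FunctionSpaces.IsTestFunctionOn
      (⟨ball (0 : EuclideanSpace ℝ (Fin 3)) ((m : ℝ) + 3), isOpen_ball⟩ :
        Opens (EuclideanSpace ℝ (Fin 3))) (ψ m i)) :
    ∃ (S : Set ℝ) (C : ℕ → ℝ≥0), (∀ᵐ t ∂(volume.restrict (Ioo a' b')), t ∈ S) ∧
      (∀ t ∈ S, AEStronglyMeasurable (u t) volume) ∧
      (∀ m : ℕ, ∀ t ∈ S, ∫⁻ x in ball (0 : EuclideanSpace ℝ (Fin 3)) ((m : ℝ) + 3), ‖u t x‖ₑ ^ 2 ≤ C m) ∧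
      ∀ m i : ℕ, ∀ s ∈ S, Tendsto
        (fun t => ∫ x in ball (0 : EuclideanSpace ℝ (Fin 3)) ((m : ℝ) + 3), ⟪u t x, ψ m i x⟫) (𝓝[S] s)
        (𝓝 (∫ x in ball (0 : EuclideanSpace ℝ (Fin 3)) ((m : ℝ) + 3), ⟪u s x, ψ m i x⟫)) := by
  choose T hT hTc using fun m i => exists_fullMeasure_tendsto_pairing hs hab ha' hb' (hψ m i)
  choose C hC using fun m : ℕ => exists_ae_lintegral_ball_sq_le hs hab ha' hb' ((m : ℝ) + 3)
  -- measurability of a.e. slice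
  have hmeas : ∀ᵐ t ∂(volume.restrict (Ioo a' b')), AEStronglyMeasurable (u t) volume := by
    have h1 : AEStronglyMeasurable (uncurry u)
        (volume.restrict (Ioo a' b' ×ˢ (univ : Set (EuclideanSpace ℝ (Fin 3))))) :=
      hs.distributional.1.aestronglyMeasurable.mono_measure (Measure.restrict_mono
        ((Set.prod_mono (Ioo_subset_Ioo ha'.le hb'.le) Subset.rfl).trans hab) le_rfl)
    have h2 := FunctionSpaces.AubinLions.ae_aestronglyMeasurable_slice h1
    rw [Measure.restrict_univ] at h2
    exact h2
  refine ⟨{t | (∀ m i, t ∈ T m i) ∧ AEStronglyMeasurable (u t) volume ∧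
      ∀ m : ℕ, ∫⁻ x in ball (0 : EuclideanSpace ℝ (Fin 3)) ((m : ℝ) + 3), ‖u t x‖ₑ ^ 2 ≤ C m}, C,
    ?_, fun t ht => ht.2.1, fun m t ht => ht.2.2 m, fun m i s hs' => ?_⟩
  · have h1 : ∀ᵐ t ∂(volume.restrict (Ioo a' b')), ∀ m i, t ∈ T m i :=
      ae_all_iff.2 fun m => ae_all_iff.2 fun i => hT m i
    have h2 : ∀ᵐ t ∂(volume.restrict (Ioo a' b')), ∀ m : ℕ,
        ∫⁻ x in ball (0 : EuclideanSpace ℝ (Fin 3)) ((m : ℝ) + 3), ‖u t x‖ₑ ^ 2 ≤ C m :=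
      ae_all_iff.2 fun m => hC m
    filter_upwards [h1, hmeas, h2] with t h1 h2 h3
    exact ⟨h1, h2, h3⟩
  · exact (hTc m i s (hs'.1 m i)).mono_left (nhdsWithin_mono s fun t ht => ht.1 m i)

/-- **Strong `L²_loc` right-continuity of a suitable weak solution at almost every time, along a
set of full measure** (the restart property: Lemarié-Rieusset 2016, p. 568, "for almost every
`T₃ ∈ (T₀, T₁)`, `u` is a local Leray solution on `(T₃, T₁)`"; Seregin 2014, Remark B.4; for
Leray–Hopf solutions, Galdi 2000, §2). Let `(u, p)` be a suitable weak solution (viscosity `1`,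
no force) on an open `Q ⊇ (a, b) × ℝ³` with `|u|³ ∈ L¹_loc(Q)`. Then for a.e. `s₀ ∈ (a, b)` there
is a set `S ⊆ ℝ` of full measure such that for every `r`,
`∫_{B(0,r)} |u(t) − u(s₀)|² → 0` as `t → s₀`, `t > s₀`, `t ∈ S`.
Proof: the energy inequality from `s₀` (`ae_energy_le_of_start_Ioo`, at Lebesgue points of the
local energies) bounds `limsup ∫ |u(t)|² φ ≤ ∫ |u(s₀)|² φ`; the pairings against a countable dense
family of test fields are continuous along a full-measure set (`exists_goodSet`); the two combine
to strong convergence (`tendsto_integral_norm_sub_sq_mul`).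
[cite: LemarieRieusset2016, Ch. 15 p. 568 (restart at a.e. time)] -/
theorem ae_tendsto_lintegral_ball_sub_sq (hs : IsSuitableWeakSolutionOn Q 1 0 u p)
    (hu3 : LocallyIntegrableOn (fun z : ℝ × EuclideanSpace ℝ (Fin 3) => ‖u z.1 z.2‖ ^ 3)
      (Q : Set _) volume)
    {a b : ℝ} (hab : Ioo a b ×ˢ (univ : Set (EuclideanSpace ℝ (Fin 3))) ⊆ (Q : Set _)) :
    ∀ᵐ s₀ ∂(volume : Measure ℝ), s₀ ∈ Ioo a b →
      ∃ S : Set ℝ, (∀ᵐ t ∂(volume : Measure ℝ), t ∈ S) ∧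
        ∀ r : ℝ, Tendsto (fun t => ∫⁻ x in ball (0 : EuclideanSpace ℝ (Fin 3)) r, ‖u t x - u s₀ x‖ₑ ^ 2)
          (𝓝[Ioi s₀ ∩ S] s₀) (𝓝 0) := by
  -- ## reduction to compact windows `(a + δₙ, b - δₙ)`
  set δ : ℕ → ℝ := fun n => 1 / ((n : ℝ) + 1) with hδ
  have hδpos : ∀ n, 0 < δ n := fun n => by positivity
  suffices H : ∀ n : ℕ, ∀ᵐ s₀ ∂(volume : Measure ℝ), s₀ ∈ Ioo (a + δ n) (b - δ n) →
      ∃ S : Set ℝ, (∀ᵐ t ∂(volume : Measure ℝ), t ∈ S) ∧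
        ∀ r : ℝ, Tendsto (fun t => ∫⁻ x in ball (0 : EuclideanSpace ℝ (Fin 3)) r, ‖u t x - u s₀ x‖ₑ ^ 2)
          (𝓝[Ioi s₀ ∩ S] s₀) (𝓝 0) by
    filter_upwards [ae_all_iff.2 H] with s₀ h hs₀
    obtain ⟨n, hn⟩ := exists_nat_one_div_lt (lt_min (sub_pos.2 hs₀.1) (sub_pos.2 hs₀.2))
    have hn' : δ n < min (s₀ - a) (b - s₀) := hn
    exact h n ⟨by linarith [min_le_left (s₀ - a) (b - s₀)], by linarith [min_le_right (s₀ - a) (b - s₀)]⟩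
  intro n
  set a' : ℝ := a + δ n with ha'
  set b' : ℝ := b - δ n with hb'
  have haa' : a < a' := by rw [ha']; linarith [hδpos n]
  have hbb' : b' < b := by rw [hb']; linarith [hδpos n]
  -- ## bumps, dense test fields, the good set, the energy inequalities
  let φb : ℕ → ContDiffBump (0 : EuclideanSpace ℝ (Fin 3)) := fun m =>
    ⟨(m : ℝ) + 1, (m : ℝ) + 2, by positivity, by linarith⟩
  set φ : ℕ → EuclideanSpace ℝ (Fin 3) → ℝ := fun m => φb m with hφ
  have hφs : ∀ m, ContDiff ℝ (⊤ : ℕ∞) (φ m) := fun m => (φb m).contDiff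
  have hφc : ∀ m, HasCompactSupport (φ m) := fun m => (φb m).hasCompactSupport
  have hφ0 : ∀ m x, 0 ≤ φ m x := fun m x => (φb m).nonneg' x
  have hφ1 : ∀ m x, φ m x ≤ 1 := fun m x => (φb m).le_one
  have hφone : ∀ m : ℕ, ∀ x ∈ closedBall (0 : EuclideanSpace ℝ (Fin 3)) ((m : ℝ) + 1), φ m x = 1 :=
    fun m x hx => (φb m).one_of_mem_closedBall hx
  have hφsupp : ∀ m : ℕ, ∀ x ∉ ball (0 : EuclideanSpace ℝ (Fin 3)) ((m : ℝ) + 3), φ m x = 0 := by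
    intro m x hx
    refine (φb m).zero_of_le_dist ?_
    rw [mem_ball] at hx
    show (m : ℝ) + 2 ≤ dist x 0
    linarith [not_lt.1 hx]
  choose ψ hψ hψd using fun m : ℕ => exists_dense_seq_isTestFunctionOn ((m : ℝ) + 3)
  obtain ⟨S, C, hS, hSm, hSC, hSp⟩ := exists_goodSet hs hab haa' hbb' ψ hψ
  -- the remainder field of the energy inequality
  set Rm : ℕ → ℝ × EuclideanSpace ℝ (Fin 3) → ℝ := fun m z =>
    ‖u z.1 z.2‖ ^ 2 * (1 * Δ (φ m) z.2) +
      (‖u z.1 z.2‖ ^ 2 + 2 * p z.1 z.2) * ⟪u z.1 z.2, gradient (φ m) z.2⟫ with hRm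
  have hE := ae_all_iff.2 fun m =>
    ae_energy_le_of_start_Ioo hs zero_le_one hu3 hab (hφs m) (hφc m) (hφ0 m) haa' hbb'
  have hS' : ∀ᵐ s₀ ∂(volume : Measure ℝ), s₀ ∈ Ioo a' b' → s₀ ∈ S :=
    (ae_restrict_iff' measurableSet_Ioo).1 hS
  filter_upwards [hE, hS'] with s₀ hEs₀ hSs₀ hs₀I
  have hs₀S : s₀ ∈ S := hSs₀ hs₀I
  -- the good set at `s₀`
  set T : Set ℝ := {t | ∀ m : ℕ, t ∈ Ioo s₀ b' →
    ∫ x, ‖u t x‖ ^ 2 * φ m x ≤ (∫ x, ‖u s₀ x‖ ^ 2 * φ m x) +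
      ∫ z in Ico s₀ t ×ˢ (univ : Set (EuclideanSpace ℝ (Fin 3))), Rm m z} with hT
  have hTae : ∀ᵐ t ∂(volume : Measure ℝ), t ∈ T := by
    have := ae_all_iff.2 fun m => hEs₀ m hs₀I
    filter_upwards [this] with t ht
    exact fun m htI => ht m htI
  set L : Set ℝ := Ioi s₀ ∩ (S ∩ T) ∩ Iio b' with hL
  refine ⟨(S ∩ T) ∪ (Ioo a' b')ᶜ, ?_, fun r => ?_⟩
  · have h1 : ∀ᵐ t ∂(volume : Measure ℝ), t ∈ Ioo a' b' → t ∈ S :=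
      (ae_restrict_iff' measurableSet_Ioo).1 hS
    filter_upwards [h1, hTae] with t h1 h2
    by_cases ht : t ∈ Ioo a' b'
    · exact Or.inl ⟨h1 ht, h2⟩
    · exact Or.inr ht
  -- ## the convergence along `L`, for the radius `r`
  obtain ⟨m, hm⟩ := exists_nat_ge r
  set B : Set (EuclideanSpace ℝ (Fin 3)) := ball (0 : EuclideanSpace ℝ (Fin 3)) ((m : ℝ) + 3) with hB
  set μB : Measure (EuclideanSpace ℝ (Fin 3)) := volume.restrict B with hμB
  have hLS : L ⊆ S := fun t ht => ht.1.2.1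
  have hl : 𝓝[L] s₀ ≤ 𝓟 S := (le_principal_iff.2 self_mem_nhdsWithin).trans (principal_mono.2 hLS)
  -- `L²(B)` data
  have hv : ∀ t ∈ S, MemLp (u t) 2 μB := fun t ht =>
    memLp_two_restrict_of_lintegral_lt_top (hSm t ht) ((hSC m t ht).trans_lt ENNReal.coe_lt_top)
  set M : ℝ := (((C m : ℝ≥0∞)) ^ (1 / 2 : ℝ)).toReal with hM
  have hM0 : 0 ≤ M := ENNReal.toReal_nonneg
  have hvb : ∀ t ∈ S, (eLpNorm (u t) 2 μB).toReal ≤ M := by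
    intro t ht
    rw [hM, FunctionSpaces.AubinLions.eLpNorm_two_eq_rpow]
    exact ENNReal.toReal_mono (ENNReal.rpow_ne_top_of_nonneg (by norm_num) ENNReal.coe_ne_top)
      (ENNReal.rpow_le_rpow (hSC m t ht) (by norm_num))
  have hψ2 : ∀ i, MemLp (ψ m i) 2 μB := fun i =>
    ((hψ m i).contDiff.continuous.memLp_of_hasCompactSupport (hψ m i).hasCompactSupport).restrict B
  have hψd' : ∀ g : EuclideanSpace ℝ (Fin 3) → EuclideanSpace ℝ (Fin 3), MemLp g 2 μB →
      ∀ ε : ℝ, 0 < ε → ∃ i, (eLpNorm (g - ψ m i) 2 μB).toReal ≤ ε := by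
    intro g hg ε hε
    obtain ⟨i, hi⟩ := hψd m g hg (ENNReal.ofReal ε) (ENNReal.ofReal_pos.2 hε).ne'
    exact ⟨i, ENNReal.toReal_le_of_le_ofReal hε.le hi⟩
  have hpair : ∀ i, Tendsto (fun t => ∫ x, ⟪u t x, ψ m i x⟫ ∂μB) (𝓝[L] s₀)
      (𝓝 (∫ x, ⟪u s₀ x, ψ m i x⟫ ∂μB)) := fun i =>
    (hSp m i s₀ hs₀S).mono_left (nhdsWithin_mono s₀ hLS)
  -- the energy control along `L`
  have hc : s₀ < (s₀ + b') / 2 := by linarith [hs₀I.2]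
  have hRint : IntegrableOn (Rm m) (Icc s₀ ((s₀ + b') / 2) ×ˢ (univ : Set (EuclideanSpace ℝ (Fin 3)))) volume :=
    integrableOn_energyRHS_Icc_prod hs hu3 hab (hφs m) (hφc m)
      (fun t ht => ⟨haa'.trans (hs₀I.1.trans_le ht.1), by linarith [ht.2, hs₀I.2]⟩)
  have hrem : Tendsto (fun t => ∫ z in Ico s₀ t ×ˢ (univ : Set (EuclideanSpace ℝ (Fin 3))), Rm m z)
      (𝓝[L] s₀) (𝓝 0) :=
    (tendsto_setIntegral_Ico_prod hc hRint).mono_left (nhdsWithin_mono s₀ fun t ht => ht.1.1)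
  have hsetB : ∀ {f : EuclideanSpace ℝ (Fin 3) → EuclideanSpace ℝ (Fin 3)},
      ∫ x, ‖f x‖ ^ 2 * φ m x ∂μB = ∫ x, ‖f x‖ ^ 2 * φ m x := by
    intro f
    rw [hμB]
    exact setIntegral_eq_integral_of_forall_compl_eq_zero fun x hx => by
      rw [hφsupp m x hx, mul_zero]
  have hen : ∀ ε : ℝ, 0 < ε → ∀ᶠ t in 𝓝[L] s₀,
      ∫ x, ‖u t x‖ ^ 2 * φ m x ∂μB ≤ (∫ x, ‖u s₀ x‖ ^ 2 * φ m x ∂μB) + ε := by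
    intro ε hε
    have h1 : ∀ᶠ t in 𝓝[L] s₀, |∫ z in Ico s₀ t ×ˢ (univ : Set (EuclideanSpace ℝ (Fin 3))), Rm m z| < ε := by
      have := (Metric.tendsto_nhds.1 hrem) ε hε
      filter_upwards [this] with t ht
      rwa [Real.dist_eq, sub_zero] at ht
    filter_upwards [h1, self_mem_nhdsWithin] with t ht1 htL
    rw [hsetB, hsetB]
    have h2 := htL.1.2.2 m ⟨htL.1.1, htL.2⟩
    linarith [le_abs_self (∫ z in Ico s₀ t ×ˢ (univ : Set (EuclideanSpace ℝ (Fin 3))), Rm m z)]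
  have hcore := tendsto_integral_norm_sub_sq_mul hl hM0 hv (hv s₀ hs₀S) hvb (hvb s₀ hs₀S)
    ((φb m).continuous.aestronglyMeasurable) (hφ0 m) (hφ1 m) hψ2 hψd' hpair hen
  -- ## from the weighted integral on `B` to `∫_{B(0,r)} |u(t) - u(s₀)|²`
  have hkey : ∀ t ∈ S, ∫⁻ x in ball (0 : EuclideanSpace ℝ (Fin 3)) r, ‖u t x - u s₀ x‖ₑ ^ 2 ≤
      ENNReal.ofReal (∫ x, ‖u t x - u s₀ x‖ ^ 2 * φ m x ∂μB) := by
    intro t ht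
    have hd : MemLp (fun x => u t x - u s₀ x) 2 μB := (hv t ht).sub (hv s₀ hs₀S)
    have hint : Integrable (fun x => ‖u t x - u s₀ x‖ ^ 2 * φ m x) μB := by
      have h1 : Integrable (fun x => ‖u t x - u s₀ x‖ ^ 2) μB :=
        (memLp_two_iff_integrable_sq_norm hd.1).1 hd
      refine (h1.bdd_mul (c := 1) ((φb m).continuous.aestronglyMeasurable) (Eventually.of_forall
        fun x => ?_)).congr (Eventually.of_forall fun x => mul_comm _ _)
      rw [Real.norm_eq_abs, abs_of_nonneg (hφ0 m x)]; exact hφ1 m x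
    rw [ofReal_integral_eq_lintegral_ofReal hint (Eventually.of_forall fun x =>
      mul_nonneg (sq_nonneg _) (hφ0 m x))]
    have hsub : ball (0 : EuclideanSpace ℝ (Fin 3)) r ⊆ B := ball_subset_ball (by linarith)
    calc ∫⁻ x in ball (0 : EuclideanSpace ℝ (Fin 3)) r, ‖u t x - u s₀ x‖ₑ ^ 2
        = ∫⁻ x in ball (0 : EuclideanSpace ℝ (Fin 3)) r, ENNReal.ofReal (‖u t x - u s₀ x‖ ^ 2 * φ m x) := by
          refine setLIntegral_congr_fun measurableSet_ball fun x hx => ?_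
          have hx1 : φ m x = 1 := hφone m x (mem_closedBall.2 (by
            have := mem_ball.1 hx; linarith))
          rw [hx1, mul_one, ← ofReal_norm, ← ENNReal.ofReal_pow (norm_nonneg _)]
      _ ≤ ∫⁻ x in B, ENNReal.ofReal (‖u t x - u s₀ x‖ ^ 2 * φ m x) := lintegral_mono_set hsub
  have hlim : Tendsto (fun t => ∫⁻ x in ball (0 : EuclideanSpace ℝ (Fin 3)) r, ‖u t x - u s₀ x‖ₑ ^ 2)
      (𝓝[L] s₀) (𝓝 0) := by
    have hup : Tendsto (fun t => ENNReal.ofReal (∫ x, ‖u t x - u s₀ x‖ ^ 2 * φ m x ∂μB))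
        (𝓝[L] s₀) (𝓝 0) := by
      have := ENNReal.tendsto_ofReal hcore
      rwa [ENNReal.ofReal_zero] at this
    refine tendsto_of_tendsto_of_tendsto_of_le_of_le' tendsto_const_nhds hup
      (Eventually.of_forall fun t => bot_le) ?_
    filter_upwards [self_mem_nhdsWithin] with t htL
    exact hkey t (hLS htL)
  -- ## change of the limiting set
  have hsub : (Ioi s₀ ∩ ((S ∩ T) ∪ (Ioo a' b')ᶜ)) ∩ Ioo a' b' ⊆ L := by
    rintro t ⟨⟨ht1, ht2⟩, ht3⟩
    rcases ht2 with h | h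
    · exact ⟨⟨ht1, h⟩, ht3.2⟩
    · exact absurd ht3 h
  have heq : 𝓝[(Ioi s₀ ∩ ((S ∩ T) ∪ (Ioo a' b')ᶜ)) ∩ Ioo a' b'] s₀ =
      𝓝[Ioi s₀ ∩ ((S ∩ T) ∪ (Ioo a' b')ᶜ)] s₀ :=
    nhdsWithin_inter_of_mem' (mem_nhdsWithin_of_mem_nhds (Ioo_mem_nhds hs₀I.1 hs₀I.2))
  rw [← heq]
  exact hlim.mono_left (nhdsWithin_mono s₀ hsub)

end Slab

/-! ### Almost every slice is weakly divergence free -/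

section DivFree

variable {E : Type*} [NormedAddCommGroup E] [InnerProductSpace ℝ E] [FiniteDimensional ℝ E]
  [MeasurableSpace E] [BorelSpace E]

variable {Q : Opens (ℝ × E)} {ν : ℝ} {u : ℝ → E → E} {p : ℝ → E → ℝ}

/-- **Almost every slice of a suitable weak solution is weakly divergence free** (Caffarelli–Kohn–
Nirenberg 1982, (2.2) is the space–time form of `div u = 0`; Robinson–Rodrigo–Sadowski 2016,
proof of Prop. 5.3: "for almost every `t`, `⟨u(t), ∇η⟩ = 0` for every `η`"). For a suitable weak
solution on `Q ⊇ (a, b) × E`, for a.e. `t ∈ (a, b)` the slice `u(t)` is weakly divergence free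
(`IsWeaklyDivFree`: against every test function, one null set for all of them — test the
space–time identity with `χ(t) θ(x)`, `χ` a plateau cut-off (`ae_integral_inner_gradient_eq_zero`),
then the separability upgrade `ae_isWeaklyDivFree_of_forall_test`).
[cite: CaffarelliKohnNirenberg1982, §2 (2.2)] -/
theorem ae_isWeaklyDivFree_slice (hs : IsSuitableWeakSolutionOn Q ν 0 u p)
    {a b : ℝ} (hab : Ioo a b ×ˢ (univ : Set E) ⊆ (Q : Set (ℝ × E))) :
    ∀ᵐ t ∂(volume : Measure ℝ), t ∈ Ioo a b → IsWeaklyDivFree (u t) := by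
  -- ## reduction to compact windows
  set δ : ℕ → ℝ := fun n => 1 / ((n : ℝ) + 1) with hδ
  have hδpos : ∀ n, 0 < δ n := fun n => by positivity
  suffices H : ∀ n : ℕ, ∀ᵐ t ∂(volume.restrict (Ioo (a + δ n) (b - δ n))), IsWeaklyDivFree (u t) by
    have H' : ∀ n : ℕ, ∀ᵐ t ∂(volume : Measure ℝ), t ∈ Ioo (a + δ n) (b - δ n) →
        IsWeaklyDivFree (u t) := fun n => (ae_restrict_iff' measurableSet_Ioo).1 (H n)
    filter_upwards [ae_all_iff.2 H'] with t h ht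
    obtain ⟨n, hn⟩ := exists_nat_one_div_lt (lt_min (sub_pos.2 ht.1) (sub_pos.2 ht.2))
    have hn' : δ n < min (t - a) (b - t) := hn
    exact h n ⟨by linarith [min_le_left (t - a) (b - t)], by linarith [min_le_right (t - a) (b - t)]⟩
  intro n
  set a' : ℝ := a + δ n with ha'
  set b' : ℝ := b - δ n with hb'
  have haa' : a < a' := by rw [ha']; linarith [hδpos n]
  have hbb' : b' < b := by rw [hb']; linarith [hδpos n]
  rcases le_or_gt b' a' with hba | hba
  · rw [Ioo_eq_empty_of_le hba, Measure.restrict_empty]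
    exact ae_zero.le (by simp)
  -- ## measurability and local square integrability of a.e. slice
  have hmeas : ∀ᵐ t ∂(volume.restrict (Ioo a' b')), AEStronglyMeasurable (u t) volume := by
    have h1 : AEStronglyMeasurable (uncurry u) (volume.restrict (Ioo a' b' ×ˢ (univ : Set E))) :=
      hs.distributional.1.aestronglyMeasurable.mono_measure (Measure.restrict_mono
        ((Set.prod_mono (Ioo_subset_Ioo haa'.le hbb'.le) Subset.rfl).trans hab) le_rfl)
    have h2 := FunctionSpaces.AubinLions.ae_aestronglyMeasurable_slice h1
    rw [Measure.restrict_univ] at h2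
    exact h2
  choose C hC using fun k : ℕ => exists_ae_lintegral_ball_sq_le hs hab haa' hbb' ((k : ℝ) + 1)
  have hv : ∀ᵐ t ∂(volume.restrict (Ioo a' b')), AEStronglyMeasurable (u t) volume ∧
      ∀ k : ℕ, ∫⁻ x in closedBall (0 : E) k, ‖u t x‖ₑ ^ 2 < ∞ := by
    filter_upwards [hmeas, ae_all_iff.2 hC] with t h1 h2
    exact ⟨h1, fun k => ((lintegral_mono_set (closedBall_subset_ball (by linarith))).trans
      (h2 k)).trans_lt ENNReal.coe_lt_top⟩
  -- ## a plateau cut-off `χ = 1` on `[a', b']`, supported in `(a, b)`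
  set c : ℝ := (a' + b') / 2 with hc
  set ρ : ℝ := (b' - a') / 2 with hρ
  have hρpos : 0 < ρ := by rw [hρ]; linarith
  let χb : ContDiffBump c := ⟨ρ, ρ + δ n / 2, hρpos, by linarith [hδpos n]⟩
  have hχ1 : ∀ t ∈ Icc a' b', (χb : ℝ → ℝ) t = 1 := fun t ht =>
    χb.one_of_mem_closedBall (by
      rw [mem_closedBall, Real.dist_eq]
      show |t - c| ≤ ρ
      rw [hc, hρ, abs_le]
      constructor <;> linarith [ht.1, ht.2])
  have hχ0 : ∀ t, t ∉ Icc (a' - δ n / 2) (b' + δ n / 2) → (χb : ℝ → ℝ) t = 0 := by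
    intro t ht
    refine χb.zero_of_le_dist ?_
    show ρ + δ n / 2 ≤ dist t c
    rw [Real.dist_eq]
    rcases not_and_or.1 (fun h => ht ⟨h.1, h.2⟩) with h | h
    · have h' := not_le.1 h
      rw [abs_of_neg (by rw [hc]; linarith)]
      simp only [hc, hρ]; linarith
    · have h' := not_le.1 h
      rw [abs_of_pos (by rw [hc]; linarith)]
      simp only [hc, hρ]; linarith
  have hIcc : Icc (a' - δ n / 2) (b' + δ n / 2) ⊆ Ioo a b := fun t ht =>
    ⟨by rw [ha'] at ht; linarith [ht.1, hδpos n], by rw [hb'] at ht; linarith [ht.2, hδpos n]⟩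
  -- ## test-wise a.e. vanishing, then the separability upgrade
  refine ae_isWeaklyDivFree_of_forall_test hv fun θ hθ => ?_
  have htest : IsSpaceTimeTestOn Q (fun t x => (χb : ℝ → ℝ) t * θ x) :=
    isSpaceTimeTestOn_mul hab χb.contDiff hIcc hχ0 hθ.contDiff hθ.hasCompactSupport
  have h1 := ae_integral_inner_gradient_eq_zero hs.distributional.1 hs.distributional.2.2.2.1 htest
  have h2 : ∀ᵐ t ∂(volume : Measure ℝ), t ∈ Ioo a' b' → ∫ x, ⟪u t x, gradient θ x⟫ = 0 := by
    filter_upwards [h1] with t ht htI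
    have e : (fun x => (χb : ℝ → ℝ) t * θ x) = θ := by
      funext x; rw [hχ1 t (Ioo_subset_Icc_self htI), one_mul]
    rwa [e] at ht
  exact (ae_restrict_iff' measurableSet_Ioo).2 h2

end DivFree

end SuitableRestart

end Literature.Analysis.FluidPDE
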